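import Literature.MathematicalPhysics.QuantumLattice.MatrixProductStates
import Literature.Computability.QuantumComplexity.SolovayKitaev.Basic
import HarnessLib

/-!
# Norm bounds for traces of endomorphisms of `M_D(ℂ)` and for generalised transfer operators

Helper file towards the discharge of
`Literature.MathematicalPhysics.QuantumLattice.fannes_nachtergaele_werner_decay`
(`LiebRobinson.lean`, proof in `LiebRobinsonFNWDecayProofs.lean`). Theorems only; no definition,
no named fact. All norms are L²-operator norms (scoped `Matrix.Norms.L2Operator`); the entry
bound `|M i j| ≤ ‖M‖` is reused from `SolovayKitaev.Basic` (`norm_apply_le_norm`).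

* `norm_trace_end_le` — if `‖S X‖ ≤ M ‖X‖` for all `X ∈ M_n(ℂ)` then
  `|Tr_{End(M_n)} S| ≤ M Σ_p ‖E_p‖` (matrix units `E_p = Matrix.stdBasis`);
* `norm_transferOpGen_apply_le` — `‖𝔼_g(X)‖ ≤ (Σ_{ij} ‖A^j‖ ‖A^i‖) ‖g‖ ‖X‖` for the generalised
  transfer operator `𝔼_g = Σ_{ij} g_{ij} (X ↦ A^j X (A^i)†)` of an MPS tensor;
* `fnw_corr_identity`, `fnw_corr_bound` — the elementary algebra and norm estimate in `ℂ` behind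
  the clustering bound (the remainder bookkeeping of Fannes–Nachtergaele–Werner 1992, Lemma 5.2,
  p. 467).

## Source

M. Fannes, B. Nachtergaele, R. F. Werner, Comm. Math. Phys. **144** (1992) 443–490, §5
Lemma 5.2. [FannesNachtergaeleWernerCMP1992]
-/

noncomputable section

open Matrix
open scoped ComplexOrder Matrix.Norms.L2Operator
open Literature.Computability.QuantumComplexity.SolovayKitaev (norm_apply_le_norm)

namespace Literature.MathematicalPhysics.QuantumLattice

section QLattice

variable {q D : ℕ}

/-! ### Norm bounds: entries, traces of endomorphisms, generalised transfer operators -/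

section Bounds

variable {n : Type*} [Fintype n] [DecidableEq n]

/-- **Trace of an endomorphism of `M_n(ℂ)` from a pointwise bound**: if `‖S X‖ ≤ M ‖X‖` for all
`X` then `|Tr S| ≤ M κ` with `κ = Σ_p ‖E_p‖` the total norm of the matrix units (compute the
trace in the basis of matrix units and bound each diagonal entry by the operator norm,
`norm_apply_le_norm` of `SolovayKitaev.Basic`).
[folklore] -/
theorem norm_trace_end_le (S : Module.End ℂ (Matrix n n ℂ)) {M : ℝ}
    (h : ∀ X, ‖S X‖ ≤ M * ‖X‖) :
    ‖LinearMap.trace ℂ _ S‖ ≤ M * ∑ p : n × n, ‖Matrix.stdBasis ℂ n n p‖ := by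
  have hrepr : ∀ (X : Matrix n n ℂ) (p : n × n), (Matrix.stdBasis ℂ n n).repr X p = X p.1 p.2 := by
    intro X p
    simp [Matrix.stdBasis]
  rw [LinearMap.trace_eq_matrix_trace ℂ (Matrix.stdBasis ℂ n n), Matrix.trace]
  simp only [Matrix.diag_apply, LinearMap.toMatrix_apply, hrepr]
  rw [Finset.mul_sum]
  refine (norm_sum_le _ _).trans (Finset.sum_le_sum fun p _ => ?_)
  exact (norm_apply_le_norm _ _ _).trans (h _)

end Bounds

/-- **Bound on the generalised transfer operator**:
`‖𝔼_g(X)‖ ≤ (Σ_{ij} ‖A^j‖ ‖A^i‖) ‖g‖ ‖X‖`. [folklore] -/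
theorem norm_transferOpGen_apply_le (A : MPSTensor q D) (g : Matrix (Fin q) (Fin q) ℂ)
    (X : Matrix (Fin D) (Fin D) ℂ) :
    ‖(∑ i : Fin q, ∑ j : Fin q, g i j • LinearMap.mulLeftRight ℂ (A j, (A i)ᴴ)) X‖ ≤
      (∑ i : Fin q, ∑ j : Fin q, ‖A j‖ * ‖A i‖) * ‖g‖ * ‖X‖ := by
  simp only [LinearMap.sum_apply, LinearMap.smul_apply, LinearMap.mulLeftRight_apply]
  rw [Finset.sum_mul, Finset.sum_mul]
  refine (norm_sum_le _ _).trans (Finset.sum_le_sum fun i _ => ?_)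
  rw [Finset.sum_mul, Finset.sum_mul]
  refine (norm_sum_le _ _).trans (Finset.sum_le_sum fun j _ => ?_)
  rw [norm_smul]
  calc ‖g i j‖ * ‖A j * X * (A i)ᴴ‖ ≤ ‖g‖ * (‖A j‖ * ‖X‖ * ‖A i‖) := by
        refine mul_le_mul (norm_apply_le_norm g i j) ?_ (norm_nonneg _) (norm_nonneg _)
        exact norm_mul₃_le.trans (by rw [l2_opNorm_conjTranspose])
    _ = ‖A j‖ * ‖A i‖ * ‖g‖ * ‖X‖ := by ring

/-! ### Elementary bookkeeping in `ℂ` -/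

/-- The algebraic identity behind the clustering estimate: with `u (1 + ε) = 1`,
`r²(αβ + ρ)u - (r(α + δ_a)u)(r(β + δ_b)u) = r²u²(αβ ε + ρ(1 + ε) - α δ_b - δ_a β - δ_a δ_b)`.
[folklore] -/
theorem fnw_corr_identity (αa αb δa δb ρ ε u r : ℂ) (hu : u * (1 + ε) = 1) :
    r ^ 2 * (αa * αb + ρ) * u - (r * (αa + δa) * u) * (r * (αb + δb) * u) =
      r ^ 2 * u ^ 2 * (αa * αb * ε + ρ * (1 + ε) - αa * δb - δa * αb - δa * δb) := by
  have h : r ^ 2 * (αa * αb + ρ) * u = r ^ 2 * (αa * αb + ρ) * u * (u * (1 + ε)) := by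
    rw [hu, mul_one]
  rw [h]
  ring

/-- The norm estimate behind the clustering estimate: all remainders carry a factor `E ≤ 1`,
`|ε| ≤ ½`, `|u| ≤ 2`. [folklore] -/
theorem fnw_corr_bound {αa αb δa δb ρ ε u : ℂ} {A₁ A₂ D₁ D₂ Rρ Eε E : ℝ}
    (hA₁ : 0 ≤ A₁) (hA₂ : 0 ≤ A₂) (hD₁ : 0 ≤ D₁) (hD₂ : 0 ≤ D₂) (hE0 : 0 ≤ E) (hE1 : E ≤ 1)
    (hαa : ‖αa‖ ≤ A₁) (hαb : ‖αb‖ ≤ A₂) (hδa : ‖δa‖ ≤ D₁ * E) (hδb : ‖δb‖ ≤ D₂ * E)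
    (hρ : ‖ρ‖ ≤ Rρ * E) (hε : ‖ε‖ ≤ Eε * E) (hε' : ‖ε‖ ≤ 1 / 2) (hu : ‖u‖ ≤ 2) :
    ‖u ^ 2 * (αa * αb * ε + ρ * (1 + ε) - αa * δb - δa * αb - δa * δb)‖ ≤
      4 * (A₁ * A₂ * Eε + Rρ * (3 / 2) + A₁ * D₂ + D₁ * A₂ + D₁ * D₂) * E := by
  have hu2 : ‖u ^ 2‖ ≤ 4 := by
    rw [norm_pow]
    nlinarith [norm_nonneg u]
  have h1ε : ‖1 + ε‖ ≤ 3 / 2 := by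
    calc ‖1 + ε‖ ≤ ‖(1 : ℂ)‖ + ‖ε‖ := norm_add_le _ _
      _ ≤ 1 + 1 / 2 := by rw [norm_one]; linarith
      _ = 3 / 2 := by norm_num
  have hRρ : 0 ≤ Rρ * E := (norm_nonneg _).trans hρ
  have t1 : ‖αa * αb * ε‖ ≤ A₁ * A₂ * Eε * E := by
    rw [norm_mul, norm_mul, mul_assoc (A₁ * A₂)]
    exact mul_le_mul (mul_le_mul hαa hαb (norm_nonneg _) hA₁) hε (norm_nonneg _)
      (mul_nonneg hA₁ hA₂)
  have t2 : ‖ρ * (1 + ε)‖ ≤ Rρ * E * (3 / 2) := by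
    rw [norm_mul]
    exact mul_le_mul hρ h1ε (norm_nonneg _) hRρ
  have t3 : ‖αa * δb‖ ≤ A₁ * (D₂ * E) := by
    rw [norm_mul]
    exact mul_le_mul hαa hδb (norm_nonneg _) hA₁
  have t4 : ‖δa * αb‖ ≤ D₁ * E * A₂ := by
    rw [norm_mul]
    exact mul_le_mul hδa hαb (norm_nonneg _) (mul_nonneg hD₁ hE0)
  have t5 : ‖δa * δb‖ ≤ D₁ * E * (D₂ * E) := by
    rw [norm_mul]
    exact mul_le_mul hδa hδb (norm_nonneg _) (mul_nonneg hD₁ hE0)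
  have t5' : D₁ * E * (D₂ * E) ≤ D₁ * D₂ * E := by
    have : D₁ * E * (D₂ * E) = (D₁ * D₂ * E) * E := by ring
    rw [this]
    exact mul_le_of_le_one_right (by positivity) hE1
  have hin : ‖αa * αb * ε + ρ * (1 + ε) - αa * δb - δa * αb - δa * δb‖ ≤
      (A₁ * A₂ * Eε + Rρ * (3 / 2) + A₁ * D₂ + D₁ * A₂ + D₁ * D₂) * E := by
    calc ‖αa * αb * ε + ρ * (1 + ε) - αa * δb - δa * αb - δa * δb‖
        ≤ ‖αa * αb * ε‖ + ‖ρ * (1 + ε)‖ + ‖αa * δb‖ + ‖δa * αb‖ + ‖δa * δb‖ := by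
          refine (norm_sub_le _ _).trans ?_
          refine add_le_add ((norm_sub_le _ _).trans (add_le_add ((norm_sub_le _ _).trans
            (add_le_add (norm_add_le _ _) le_rfl)) le_rfl)) le_rfl
      _ ≤ A₁ * A₂ * Eε * E + Rρ * E * (3 / 2) + A₁ * (D₂ * E) + D₁ * E * A₂ + D₁ * D₂ * E := by
          linarith [t5.trans t5']
      _ = (A₁ * A₂ * Eε + Rρ * (3 / 2) + A₁ * D₂ + D₁ * A₂ + D₁ * D₂) * E := by ring
  rw [norm_mul]
  calc ‖u ^ 2‖ * ‖αa * αb * ε + ρ * (1 + ε) - αa * δb - δa * αb - δa * δb‖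
      ≤ 4 * ((A₁ * A₂ * Eε + Rρ * (3 / 2) + A₁ * D₂ + D₁ * A₂ + D₁ * D₂) * E) :=
        mul_le_mul hu2 hin (norm_nonneg _) (by norm_num)
    _ = _ := by ring


end QLattice

end Literature.MathematicalPhysics.QuantumLattice
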